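import Mathlib.LinearAlgebra.Matrix.Dual
import Mathlib.LinearAlgebra.Dual.Lemmas
import Literature.Topology.FourManifolds.LeeRasmussen
import Literature.Topology.FourManifolds.KhComplexQDegreeProofs
import HarnessLib

/-!
# The Lee complex of the mirror diagram is the dual complex; `s(K̄) = -s(K)` reduced to `d² = 0`
# and `s_max = s_min + 2`

Sibling proof file of `LeeRasmussen.lean` (D-0014), towards the named fact
`Literature.Topology.FourManifolds.GaussDiagram.rasmussenInvariant_mirror`
(**the Rasmussen invariant of the mirror of a knot diagram is `-s`**; Rasmussen (2010), Prop. 3.9: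
`s_max(K̄) = -s_min(K)`, `s_min(K̄) = -s_max(K)`, `s(K̄) = -s(K)`).

Main results (all sorry-free, no new named fact):

* `GaussDiagram.incidence_mirror` — **the cube of resolutions of the mirror diagram `Ḡ` is the
  dual cube**: under the bijection `EnhancedState.mirror` (complementary smoothings, labels
  `1 ↔ X`), which negates both gradings (`homDegree_mirror`, `qDegree_mirror`), the incidence
  number of `Ḡ` over `R[X]/(X² - t)` (`h = 0`, every `t`, every commutative ring `R`) between
  mirrored enhanced states is the *reversed* incidence number of `G`, up to the sign
  `(-1) ^ (twist + twist')` (`twist σ = Σ_{σ j = 1} j` absorbs the change of Koszul signs). This is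
  Rasmussen's isomorphism `R : CKh'(K̄) → (CKh'(K))*` built from `r : (V, m, Δ) → (V*, Δ*, m*)`,
  `x± ↦ x∓*` (Rasmussen (2010), proof of Prop. 3.9; Khovanov (2000), §7.3). Ingredients: the
  state graph of `Ḡ` at `σᶜ` *is* the state graph of `G` at `σ` (`stateGraph_mirror_compl`), a
  merge of `Ḡ` is a split of `G` read backwards and conversely (`isMergeAt_mirror_compl`,
  `isSplitAt_mirror_compl`, via the local-strand lemma `underStrands_reachable`), and the table
identity
  `m(x̄, ȳ)_{z̄} = Δ(z)_{x ⊗ y}` at `h = 0` (`mergeCoeff_not`).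
* `GaussDiagram.mirrorDual_khovanovD` — packaging: the linear equivalences
  `mirrorDual i j : (Ḡ.degStates i → ℚ) ≃ₗ[ℚ] Dual ℚ (G.degStates j → ℚ)` (`i + j = 0`)
  intertwine Lee's differential of `Ḡ` with the dual (`LinearMap.dualMap`) of Lee's differential
  of `G`; hence in degree `0` the cycles of `Ḡ` are the annihilator of the boundaries of `G` and
  the boundaries of `Ḡ` the annihilator of the cycles (`ker_mirror_eq`, `range_mirror_eq`).
* `LeeDuality.sMaxOf_dual` — **filtered duality** (linear algebra, replacing Rasmussen's
  Lemma 3.10 on dual spectral sequences by an elementary statement): for subspaces `B ≤ Z` of a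
  finite-dimensional space with a graded basis, `s_max` of the dual subquotient `B⁰/Z⁰` for the
  dual basis and the negated grading equals `-s_min` of `Z/B` (`negDeg`, with `⊥ ↔ ⊤`). Proof:
  `s_max' ≤ k ↔ B⁰ ⊓ (F_{-k})⁰ ≤ Z⁰ ↔ Z ≤ B ⊔ F_{-k} ↔ Z ≤ B ⊔ (Z ⊓ F_{-k}) ↔ -k ≤ s_min`, the
  third step being the modular law, which is where `B ≤ Z` (`d² = 0`) is needed. Without
  `B ≤ Z` the identity fails (e.g. `Z = ⟨e₁ + e₂⟩`, `B = ⟨e₁⟩`, `q = (0, 10, 10)` on `K³`).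
* `GaussDiagram.leeSMax_mirror_eq_negDeg`, `GaussDiagram.leeSMin_mirror_eq_negDeg` —
  **`s_max(Ḡ) = -s_min(G)` and `s_min(Ḡ) = -s_max(G)`** for every Gauss diagram whose Lee
  differential has `im d₋₁ ≤ ker d₀` (the first two lines of Rasmussen (2010), Prop. 3.9,
  conditional only on `d² = 0` in degree `0`; `LeeDuality.sMinOf_dual` is the second duality).
* `GaussDiagram.rasmussenInvariant_mirror_of` — **the named fact `rasmussenInvariant_mirror`
  follows from the named facts `khovanovD_comp_khovanovD` (over `ℚ`) and
  `leeSMax_eq_leeSMin_add_two`** (Rasmussen (2010), Prop. 3.3): `s(Ḡ) = s_max(Ḡ) - 1 =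
  -s_min(G) - 1 = -(s_max(G) - 1) = -s(G)`. The discharge `rasmussenInvariant_mirror_holds`
  itself waits for those two facts (`d² = 0` needs planarity of realisable diagrams;
  Prop. 3.3 needs Lee's canonical generators).

## References

* J. Rasmussen, *Khovanov homology and the slice genus*, Invent. Math. 182 (2010) 419–447
  (arXiv:math/0402131), §3: Def. 3.1 (`s_min`, `s_max`), Prop. 3.3 (`s_max = s_min + 2`),
  Def. 3.4 (`s = s_max - 1`), §3.2 Prop. 3.9 (mirror image: `CKh'(K̄) ≅ (CKh'(K))*` as filtered
  complexes, `s(K̄) = -s(K)`), Lemma 3.10 (dual filtered complexes).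
[cite: Rasmussen2010, Prop. 3.9]
* M. Khovanov, *A categorification of the Jones polynomial*, Duke Math. J. 101 (2000) 359–426,
  §7.3 (the complex of the mirror image is the dual complex), Prop. 8 (`d² = 0`).
  [cite: Khovanov2000, §7.3]
* O. Viro, *Khovanov homology, its definitions and ramifications*, Fund. Math. 184 (2004)
  317–342, §5 (enhanced states, incidence numbers). [cite: Viro2004, §5]
* Tree: `KhComplexQDegreeProofs` (`EnhancedState.label_eq_of_reachable`: labels are constant
  along state circles). (`n₊ + n₋ = n` is re-derived inline where needed, to keep the import
  closure small; cf. `KhResolutionsCircleProofs.nPlus_add_nMinus`.)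
* Mathlib: `Module.Dual`, `LinearMap.dualMap`, `Submodule.dualAnnihilator`
  (`LinearMap.ker_dualMap_eq_dualAnnihilator_range`,
`LinearMap.range_dualMap_eq_dualAnnihilator_ker`,
  `Subspace.dualAnnihilator_le_dualAnnihilator_iff`, `Submodule.dualAnnihilator_sup_eq`),
  `Module.Basis.dualBasis`, `dotProductEquiv`, the modular law `sup_inf_assoc_of_le`.

## Design choices

* Everything is proved for abstract (possibly virtual) Gauss diagrams: the duality of cubes needs
  no planarity (the "neither merge nor split" edges of `G` and `Ḡ` correspond to each other and
  both carry `0`). Realisability enters only through the two named facts in the final reduction.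
* Degrees are threaded as pairs `(i, j)` with `i + j = 0` (`degStatesMirrorEquiv`, `mirrorDual`)
  so that no cast along `-(0 + 1) = 0 - 1` is ever needed; the degree-`0` statements use the
  literal indices `0 - 1`, `0`, `0 + 1` of `LeeRasmussen.leeCycles` / `frobeniusHomology`.
* `s_min`, `s_max` are recast in elementary terms (`LeeDuality.sMinOf`, `sMaxOf`: suprema over
  cycles off the boundaries, `leeSMax_eq_sMaxOf`, `leeSMin_eq_sMinOf`) for an arbitrary basis,
  so that the dual side is literally the case of the dual basis.
-/

open Function Set

noncomputable section

namespace Literature.Topology.FourManifolds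

namespace GaussDiagram

variable (G : GaussDiagram)

/-! ## Mirror bookkeeping -/

/-- The mirror diagram has the same number of chords. [folklore] -/
@[simp] theorem mirror_n : G.mirror.n = G.n := rfl

/-- The over-passages of the mirror diagram are the under-passages. [folklore] -/
@[simp] theorem mirror_overPos : G.mirror.overPos = G.underPos := rfl

/-- The under-passages of the mirror diagram are the over-passages. [folklore] -/
@[simp] theorem mirror_underPos : G.mirror.underPos = G.overPos := rfl

/-- The signs of the mirror diagram are the opposite signs. [folklore] -/
@[simp] theorem mirror_sign (i : Fin G.n) : G.mirror.sign i = -G.sign i := rfl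

/-- The arcs of the mirror diagram are the arcs of the diagram (entering arcs). [folklore] -/
@[simp] theorem mirror_arcIn : G.mirror.arcIn = G.arcIn := rfl

/-- The arcs of the mirror diagram are the arcs of the diagram (leaving arcs). [folklore] -/
@[simp] theorem mirror_arcOut : G.mirror.arcOut = G.arcOut := rfl

/-- The chord through a marked point is the same in the mirror diagram. [folklore] -/
@[simp] theorem chordOf_mirror (p : Fin (2 * G.n)) : G.mirror.chordOf p = G.chordOf p := by
  obtain ⟨i, rfl | rfl⟩ := G.exists_chord p
  · exact (G.mirror.chordOf_underPos i).trans (G.chordOf_overPos i).symm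
  · exact (G.mirror.chordOf_overPos i).trans (G.chordOf_underPos i).symm

/-- The partner of a marked point is the same in the mirror diagram. [folklore] -/
@[simp] theorem partner_mirror (p : Fin (2 * G.n)) : G.mirror.partner p = G.partner p := by
  obtain ⟨i, rfl | rfl⟩ := G.exists_chord p
  · exact (G.mirror.partner_underPos i).trans (G.partner_overPos i).symm
  · exact (G.mirror.partner_overPos i).trans (G.partner_underPos i).symm

variable {G} in
/-- The complementary state, viewed as a state of the mirror diagram. [cite: Khovanov2000, §7.3] -/
def State.compl (σ : G.State) : G.mirror.State := fun i ↦ !σ i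

variable {G} in
/-- The complementary state flips every smoothing. [folklore] -/
@[simp] theorem State.compl_apply (σ : G.State) (i : Fin G.n) : σ.compl i = !σ i := rfl

/-- For a unit `u` of `ℤ`, `-u = 1` exactly when `u ≠ 1`. [folklore] -/
private theorem negUnits_beq_one (u : ℤˣ) : ((-u) == 1) = !(u == 1) := by
  rcases Int.units_eq_one_or u with rfl | rfl <;> decide

variable {G} in
/-- Switching a crossing and its smoothing simultaneously does not change whether the smoothing is
Seifert's: the `0`-smoothing of a crossing of the mirror is the `1`-smoothing of the original
crossing. Khovanov (2000), §7.3 (mirror image). [cite: Khovanov2000, §7.3] -/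
@[simp] theorem isSeifert_mirror_compl (σ : G.State) (i : Fin G.n) :
    G.mirror.isSeifert σ.compl i = G.isSeifert σ i := by
  simp only [isSeifert, State.compl_apply, mirror_sign, negUnits_beq_one]
  cases σ i <;> cases (G.sign i == 1) <;> rfl

variable {G} in
/-- The reconnection relation of the complementary state of the mirror is that of the state.
[cite: Khovanov2000, §7.3] -/
theorem stateAdj_mirror_compl (σ : G.State) (a b : G.Arc) :
    G.mirror.stateAdj σ.compl a b ↔ G.stateAdj σ a b := by
  simp only [stateAdj, chordOf_mirror, partner_mirror, isSeifert_mirror_compl, mirror_arcIn,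
    mirror_arcOut, mirror_n]
  exact Iff.rfl

variable {G} in
/-- **The resolution of the mirror at the complementary state is the resolution of the diagram at
the state** (same state graph, hence the same state circles). Khovanov (2000), §7.3.
[cite: Khovanov2000, §7.3] -/
@[simp] theorem stateGraph_mirror_compl (σ : G.State) :
    G.mirror.stateGraph σ.compl = G.stateGraph σ := by
  ext a b
  simp only [stateGraph, SimpleGraph.fromRel_adj, stateAdj_mirror_compl]
  exact Iff.rfl

end GaussDiagram
end Literature.Topology.FourManifolds

namespace Literature.Topology.FourManifolds
namespace GaussDiagram

variable {G : GaussDiagram}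

/-! ## Enhanced states of the mirror -/

/-- Two enhanced states with the same state and the same labels are equal. [folklore] -/
private theorem enhancedState_ext {s t : G.EnhancedState} (h1 : s.state = t.state) (h2 : s.label = t.label) :
    s = t := by
  cases s; cases t; simp only at h1 h2; subst h1 h2; rfl

/-- Complementing twice gives the state back. [folklore] -/
theorem State.compl_compl (σ : G.State) : (State.compl (G := G.mirror) σ.compl : Fin G.n → Bool) = σ :=
  funext fun i ↦ Bool.not_not (σ i)

/-- Complementing commutes with changing one smoothing (to the opposite value). [folklore] -/
theorem State.compl_update (σ : G.State) (i : Fin G.n) (b : Bool) :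
    State.compl (update σ i b) = update σ.compl i (!b) := by
  funext j
  rcases eq_or_ne j i with rfl | h
  · simp
  · have h1 : update σ i b j = σ j := update_of_ne h _ _
    have h2 : update σ.compl i (!b) j = σ.compl j := update_of_ne h _ _
    rw [h2]
    show (!(update σ i b j)) = !σ j
    rw [h1]

/-- The **mirror** of an enhanced state: complementary smoothings, opposite labels.
[cite: Khovanov2000, §7.3] -/
def EnhancedState.mirror (s : G.EnhancedState) : G.mirror.EnhancedState where
  state := s.state.compl
  label := fun a ↦ !s.label a
  label_eq := fun a b hab ↦ by
    rw [stateGraph_mirror_compl] at hab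
    rw [s.label_eq a b hab]

/-- The state of the mirrored enhanced state is the complementary state. [cite: Khovanov2000, §7.3]
-/
@[simp] theorem EnhancedState.mirror_state (s : G.EnhancedState) : s.mirror.state = s.state.compl := rfl

/-- The labels of the mirrored enhanced state are the opposite labels (`1 ↔ X`).
[cite: Khovanov2000, §7.3] -/
@[simp] theorem EnhancedState.mirror_label (s : G.EnhancedState) (a : G.Arc) :
    s.mirror.label a = !s.label a := rfl

/-- The inverse of `EnhancedState.mirror`. [cite: Khovanov2000, §7.3] -/
def EnhancedState.unmirror (S : G.mirror.EnhancedState) : G.EnhancedState where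
  state := fun i ↦ !S.state i
  label := fun a ↦ !S.label a
  label_eq := fun a b hab ↦ by
    have h := stateGraph_mirror_compl (G := G) (fun i ↦ !S.state i)
    have hc : (State.compl (G := G) fun i ↦ !S.state i) = S.state := funext fun i ↦ Bool.not_not _
    rw [hc] at h
    rw [← h] at hab
    rw [S.label_eq a b hab]

variable (G) in
/-- Enhanced states of `G` and of its mirror correspond bijectively. [cite: Khovanov2000, §7.3] -/
def mirrorStates : G.EnhancedState ≃ G.mirror.EnhancedState where
  toFun := EnhancedState.mirror
  invFun := EnhancedState.unmirror
  left_inv _ := enhancedState_ext (funext fun _ ↦ Bool.not_not _) (funext fun _ ↦ Bool.not_not _)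
  right_inv _ := enhancedState_ext (funext fun _ ↦ Bool.not_not _) (funext fun _ ↦ Bool.not_not _)

/-- `mirrorStates` is `EnhancedState.mirror`. [cite: Khovanov2000, §7.3] -/
@[simp] theorem mirrorStates_apply (s : G.EnhancedState) : G.mirrorStates s = s.mirror := rfl

/-! ## Degrees -/

variable (G) in
/-- The mirror swaps positive and negative crossings: `n₊(Ḡ) = n₋(G)`. Bar-Natan (2002), §3.1.
[cite: BarNatan2002, §3.1] -/
theorem nPlus_mirror : G.mirror.nPlus = G.nMinus := by
  show (Finset.univ.filter fun i : Fin G.n ↦ -G.sign i = 1).card =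
    (Finset.univ.filter fun i : Fin G.n ↦ G.sign i = -1).card
  exact congrArg Finset.card (Finset.filter_congr fun i _ ↦ neg_eq_iff_eq_neg)

variable (G) in
/-- The mirror swaps positive and negative crossings: `n₋(Ḡ) = n₊(G)`. Bar-Natan (2002), §3.1.
[cite: BarNatan2002, §3.1] -/
theorem nMinus_mirror : G.mirror.nMinus = G.nPlus := by
  show (Finset.univ.filter fun i : Fin G.n ↦ -G.sign i = -1).card =
    (Finset.univ.filter fun i : Fin G.n ↦ G.sign i = 1).card
  exact congrArg Finset.card (Finset.filter_congr fun i _ ↦ neg_inj)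

/-- The weights of a state and of its complement add up to the number of chords. [folklore] -/
theorem State.weight_compl_add (σ : G.State) : σ.compl.weight + σ.weight = G.n := by
  show (Finset.univ.filter fun i : Fin G.n ↦ (!σ i) = true).card +
    (Finset.univ.filter fun i : Fin G.n ↦ σ i = true).card = G.n
  have : (Finset.univ.filter fun i : Fin G.n ↦ (!σ i) = true) =
      Finset.univ.filter fun i ↦ ¬ σ i = true := by
    ext i; simp
  rw [this, add_comm, Finset.card_filter_add_card_filter_not, Finset.card_univ,
    Fintype.card_fin]

/-- **Mirroring negates the homological degree**: `i(mirror s) = -i(s)` (`|σᶜ| - n₋(Ḡ) = n - |σ| -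
n₊ = -(|σ| - n₋)`). Khovanov (2000), §7.3. [cite: Khovanov2000, §7.3] -/
theorem homDegree_mirror (s : G.EnhancedState) : homDegree s.mirror = -homDegree s := by
  have h1 := s.state.weight_compl_add
  have h2 : G.nPlus + G.nMinus = G.n := by
    unfold nPlus nMinus
    have hf : (Finset.univ.filter fun i ↦ G.sign i = -1) =
        Finset.univ.filter fun i ↦ ¬ G.sign i = 1 :=
      Finset.filter_congr fun i _ ↦ by
        rcases Int.units_eq_one_or (G.sign i) with h | h <;> rw [h] <;> decide
    rw [hf, Finset.card_filter_add_card_filter_not, Finset.card_univ, Fintype.card_fin]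
  simp only [homDegree, EnhancedState.mirror_state, nMinus_mirror]
  omega

/-- The number of connected components of `H` carrying a vertex with label `b`. [folklore] -/
private def arcLabelCount {V : Type*} (H : SimpleGraph V) (ℓ : V → Bool) (b : Bool) : ℕ :=
  Nat.card {c : H.ConnectedComponent // ∃ a, H.connectedComponentMk a = c ∧ ℓ a = b}

/-- `arcLabelCount` only depends on the graph (transport along an equality of graphs). [folklore] -/
private theorem arcLabelCount_congr {V : Type*} {H H' : SimpleGraph V} (h : H = H') (ℓ : V → Bool) (b : Bool) :
    arcLabelCount H ℓ b = arcLabelCount H' ℓ b := by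
  subst h; rfl

/-- Negating all labels exchanges the two label counts. [folklore] -/
private theorem arcLabelCount_not {V : Type*} (H : SimpleGraph V) (ℓ : V → Bool) (b : Bool) :
    arcLabelCount H (fun a ↦ !ℓ a) b = arcLabelCount H ℓ (!b) := by
  unfold arcLabelCount
  refine Nat.card_congr (Equiv.subtypeEquivRight fun c ↦ ?_)
  exact exists_congr fun a ↦ and_congr_right fun _ ↦ Bool.not_eq_eq_eq_not

/-- The quantum degree expressed through `arcLabelCount` (a `Decidable`-free form of its
definition).
Bar-Natan (2002), §3.2. [cite: BarNatan2002, §3.2] -/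
private theorem qDegree_eq_arcLabelCount (s : G.EnhancedState) :
    qDegree s = (arcLabelCount (G.stateGraph s.state) s.label false : ℤ) -
      (arcLabelCount (G.stateGraph s.state) s.label true : ℤ) + s.state.weight + G.nPlus - 2 * G.nMinus := by
  unfold qDegree arcLabelCount circleOf
  rw [Nat.card_eq_fintype_card, Fintype.card_subtype, Nat.card_eq_fintype_card, Fintype.card_subtype]

/-- **Mirroring negates the quantum degree**: `j(mirror s) = -j(s)`. Khovanov (2000), §7.3.
[cite: Khovanov2000, §7.3] -/
theorem qDegree_mirror (s : G.EnhancedState) : qDegree s.mirror = -qDegree s := by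
  rw [qDegree_eq_arcLabelCount, qDegree_eq_arcLabelCount]
  have h1 := s.state.weight_compl_add
  have h2 : G.nPlus + G.nMinus = G.n := by
    unfold nPlus nMinus
    have hf : (Finset.univ.filter fun i ↦ G.sign i = -1) =
        Finset.univ.filter fun i ↦ ¬ G.sign i = 1 :=
      Finset.filter_congr fun i _ ↦ by
        rcases Int.units_eq_one_or (G.sign i) with h | h <;> rw [h] <;> decide
    rw [hf, Finset.card_filter_add_card_filter_not, Finset.card_univ, Fintype.card_fin]
  have h3 : ∀ b, arcLabelCount (G.mirror.stateGraph s.mirror.state) s.mirror.label b =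
      arcLabelCount (G.stateGraph s.state) s.label (!b) := fun b ↦ by
    rw [EnhancedState.mirror_state, arcLabelCount_congr (stateGraph_mirror_compl s.state)]
    exact arcLabelCount_not _ _ _
  rw [h3, h3, nPlus_mirror, nMinus_mirror, EnhancedState.mirror_state]
  simp only [Bool.not_false, Bool.not_true]
  omega

/-! ## Signs -/

/-- The **twist** of a state: the sum of the indices of its `1`-smoothings.
[cite: Khovanov2000, §7.3] -/
def State.koszulTwist (σ : G.State) : ℕ := ∑ j ∈ Finset.univ.filter (fun j ↦ σ j = true), (j : ℕ)

/-- Flipping a `0`-smoothing at chord `i` adds `i` to the twist. [folklore] -/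
theorem State.koszulTwist_update {σ : G.State} {i : Fin G.n} (hi : σ i = false) :
    State.koszulTwist (update σ i true) = σ.koszulTwist + i := by
  unfold State.koszulTwist
  have h : (Finset.univ.filter fun j ↦ update σ i true j = true) =
      insert i (Finset.univ.filter fun j ↦ σ j = true) := by
    ext j
    by_cases hj : j = i
    · subst hj; simp
    · simp [hj]
  rw [h, Finset.sum_insert (by simp [hi]), add_comm]

/-- The Koszul sign of an edge of the mirror cube differs from the Koszul sign of the reversed edge
of the cube by `(-1)^i` (`i` the flipped chord): `#{j < i | σᶜ j = 1} + #{j < i | σ j = 1} = i`.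
Khovanov (2000), §7.3. [cite: Khovanov2000, §7.3] -/
theorem edgeSign_compl_update (σ : G.State) (i : Fin G.n) :
    edgeSign (State.compl (update σ i true)) i = (-1) ^ (i : ℕ) * edgeSign σ i := by
  show (-1 : ℤ) ^ (Finset.univ.filter fun j : Fin G.n ↦ j < i ∧ (!(update σ i true j)) = true).card =
    (-1) ^ (i : ℕ) * (-1) ^ (Finset.univ.filter fun j : Fin G.n ↦ j < i ∧ σ j = true).card
  have hA : (Finset.univ.filter fun j : Fin G.n ↦ j < i ∧ (!(update σ i true j)) = true) =
      Finset.univ.filter fun j ↦ j < i ∧ ¬ σ j = true := by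
    ext j
    simp only [Finset.mem_filter, Finset.mem_univ, true_and]
    constructor
    · rintro ⟨hj, h⟩
      refine ⟨hj, ?_⟩
      rw [update_of_ne hj.ne] at h
      simpa using h
    · rintro ⟨hj, h⟩
      refine ⟨hj, ?_⟩
      rw [update_of_ne hj.ne]
      simpa using h
  have hcard : (Finset.univ.filter fun j ↦ j < i ∧ ¬ σ j = true).card +
      (Finset.univ.filter fun j ↦ j < i ∧ σ j = true).card = (i : ℕ) := by
    have h1 : (Finset.univ.filter fun j ↦ j < i ∧ ¬ σ j = true) =
        (Finset.univ.filter fun j : Fin G.n ↦ j < i).filter fun j ↦ ¬ σ j = true := by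
      rw [Finset.filter_filter]
    have h2 : (Finset.univ.filter fun j ↦ j < i ∧ σ j = true) =
        (Finset.univ.filter fun j : Fin G.n ↦ j < i).filter fun j ↦ σ j = true := by
      rw [Finset.filter_filter]
    rw [h1, h2, add_comm, Finset.card_filter_add_card_filter_not]
    have : (Finset.univ.filter fun j : Fin G.n ↦ j < i) = Finset.Iio i := by ext j; simp
    rw [this, Fin.card_Iio]
  rw [hA]
  set A := (Finset.univ.filter fun j ↦ j < i ∧ ¬ σ j = true).card
  set B := (Finset.univ.filter fun j ↦ j < i ∧ σ j = true).card
  rw [← hcard, pow_add, mul_assoc, ← pow_add, ← two_mul, pow_mul]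
  simp

/-! ## The two local strands at a chord -/

/-- **The two local strands at a chord.** In every state the arcs entering/leaving the under-passage
of chord `i` lie on the state circles of the arcs leaving/entering its over-passage (Seifert
smoothing) or entering/leaving it (non-Seifert smoothing). Viro (2004), §2, §5. [cite: Viro2004, §5]
-/
private theorem underStrands_reachable (σ : G.State) (i : Fin G.n) :
    ((G.stateGraph σ).Reachable (G.arcIn (G.underPos i)) (G.arcOut (G.overPos i)) ∧
      (G.stateGraph σ).Reachable (G.arcOut (G.underPos i)) (G.arcIn (G.overPos i))) ∨
    ((G.stateGraph σ).Reachable (G.arcIn (G.underPos i)) (G.arcIn (G.overPos i)) ∧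
      (G.stateGraph σ).Reachable (G.arcOut (G.underPos i)) (G.arcOut (G.overPos i))) := by
  have h1 := G.reachable_endArc_endGlue σ (G.underPos i, false)
  have h2 := G.reachable_endArc_endGlue σ (G.underPos i, true)
  simp only [endGlue, chordOf_underPos, partner_underPos] at h1 h2
  cases hS : G.isSeifert σ i
  · simp only [hS] at h1 h2
    exact Or.inr ⟨h1, h2⟩
  · simp only [hS] at h1 h2
    exact Or.inl ⟨h1, h2⟩

/-- The two local strands at a chord are on one state circle when seen from the under-passage iff
they are when seen from the over-passage. Viro (2004), §5. [cite: Viro2004, §5] -/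
private theorem reachable_underArcs_iff (σ : G.State) (i : Fin G.n) :
    (G.stateGraph σ).Reachable (G.arcIn (G.underPos i)) (G.arcOut (G.underPos i)) ↔
      (G.stateGraph σ).Reachable (G.arcIn (G.overPos i)) (G.arcOut (G.overPos i)) := by
  rcases underStrands_reachable σ i with ⟨h1, h2⟩ | ⟨h1, h2⟩
  · constructor
    · intro h; exact h2.symm.trans (h.symm.trans h1)
    · intro h; exact h1.trans (h.symm.trans h2.symm)
  · constructor
    · intro h; exact h1.symm.trans (h.trans h2)
    · intro h; exact h1.trans (h.trans h2.symm)

/-- State circles of the mirror at the complementary state are distinct iff they are distinct state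
circles of the state. [cite: Khovanov2000, §7.3] -/
theorem circleOf_ne_mirror_compl {σ : G.State} {x y : G.Arc} :
    G.mirror.circleOf σ.compl x ≠ G.mirror.circleOf σ.compl y ↔ G.circleOf σ x ≠ G.circleOf σ y := by
  simp only [circleOf, Ne, SimpleGraph.ConnectedComponent.eq, stateGraph_mirror_compl]
  exact Iff.rfl

/-- `circleOf` form of `reachable_underArcs_iff`. Viro (2004), §5. [cite: Viro2004, §5] -/
private theorem circleOf_underArcs_ne_iff (σ : G.State) (i : Fin G.n) :
    G.circleOf σ (G.arcIn (G.underPos i)) ≠ G.circleOf σ (G.arcOut (G.underPos i)) ↔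
      G.circleOf σ (G.arcIn (G.overPos i)) ≠ G.circleOf σ (G.arcOut (G.overPos i)) := by
  simp only [circleOf, Ne, SimpleGraph.ConnectedComponent.eq, reachable_underArcs_iff]

/-- **A merge of the mirror is a split of the diagram**: the edge `σᶜ → σᶜ[i ↦ 1]` of the mirror
cube is a merge iff `σ i = 1` and the two local strands at `i` lie on different circles of `σ`, i.e.
iff the reversed edge `σ[i ↦ 0] → σ` of the cube is a split. Khovanov (2000), §7.3.
[cite: Khovanov2000, §7.3] -/
theorem isMergeAt_mirror_compl {σ : G.State} {i : Fin G.n} :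
    G.mirror.IsMergeAt σ.compl i ↔
      σ i = true ∧ G.circleOf σ (G.arcIn (G.overPos i)) ≠ G.circleOf σ (G.arcOut (G.overPos i)) := by
  rw [IsMergeAt, circleOf_ne_mirror_compl]
  simp only [State.compl_apply, Bool.not_eq_false', mirror_overPos, mirror_arcIn, mirror_arcOut,
    circleOf_underArcs_ne_iff]

/-- **A split of the mirror is a merge of the diagram**: the edge `σᶜ → σᶜ[i ↦ 1]` of the mirror
cube is a split iff the reversed edge `σ[i ↦ 0] → σ` of the cube is a merge. Khovanov (2000), §7.3.
[cite: Khovanov2000, §7.3] -/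
theorem isSplitAt_mirror_compl {σ : G.State} {i : Fin G.n} :
    G.mirror.IsSplitAt σ.compl i ↔
      σ i = true ∧ G.circleOf (update σ i false) (G.arcIn (G.overPos i)) ≠
        G.circleOf (update σ i false) (G.arcOut (G.overPos i)) := by
  rw [IsSplitAt, show update σ.compl i true = State.compl (update σ i false) by
    rw [State.compl_update]; rfl, circleOf_ne_mirror_compl]
  simp only [State.compl_apply, Bool.not_eq_false', mirror_overPos, mirror_arcIn, mirror_arcOut,
    circleOf_underArcs_ne_iff]

end GaussDiagram
end Literature.Topology.FourManifolds

namespace Literature.Topology.FourManifolds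
namespace GaussDiagram

variable {G : GaussDiagram}

/-! ## Incidence numbers of the mirror -/

section Incidence

variable {R : Type} [CommRing R]

/-- The chord flipped along an edge of the cube of resolutions is unique. [folklore] -/
private theorem flipIndex_unique {σ σ' : G.State} {i i' : Fin G.n} (hi : σ i = false) (h : σ' = update σ i true)
    (h' : σ' = update σ i' true) : i = i' := by
  by_contra hne
  have h1 : σ' i = true := by rw [h, update_self]
  have h2 : σ' i = σ i := by rw [h', update_of_ne hne]
  rw [h2, hi] at h1
  exact Bool.false_ne_true h1

variable (R) in
/-- The incidence number along an edge of the cube, with the flipped chord made explicit.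
[cite: Viro2004, §5.2] -/
private theorem incidence_eq_ite_of_flip (h t : R) {s s' : G.EnhancedState} {i : Fin G.n}
    (hi : s.state i = false) (hs' : s'.state = update s.state i true) :
    G.incidence R h t s s' =
      if G.IsMergeAt s.state i then
        (if ∀ c, G.circleOf s'.state c ≠ G.circleOf s'.state (G.arcIn (G.overPos i)) →
            s'.label c = s.label c then
          (edgeSign s.state i : R) * mergeCoeff R h t (s.label (G.arcIn (G.overPos i)))
            (s.label (G.arcOut (G.overPos i))) (s'.label (G.arcIn (G.overPos i)))
        else 0)
      else if G.IsSplitAt s.state i then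
        (if ∀ c, G.circleOf s.state c ≠ G.circleOf s.state (G.arcIn (G.overPos i)) →
            s'.label c = s.label c then
          (edgeSign s.state i : R) * splitCoeff R h t (s.label (G.arcIn (G.overPos i)))
            (s'.label (G.arcIn (G.overPos i))) (s'.label (G.arcOut (G.overPos i)))
        else 0)
      else 0 := by
  have hex : ∃ i, s.state i = false ∧ s'.state = update s.state i true := ⟨i, hi, hs'⟩
  have hci : Classical.choose hex = i :=
    flipIndex_unique (Classical.choose_spec hex).1 (Classical.choose_spec hex).2 hs'
  subst hci
  rw [incidence, dif_pos hex]

variable (R) in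
/-- Off the edges of the cube the incidence number vanishes. [cite: Viro2004, §5.2] -/
private theorem incidence_eq_zero_of_no_flip (h t : R) {s s' : G.EnhancedState}
    (hn : ¬ ∃ i, s.state i = false ∧ s'.state = update s.state i true) :
    G.incidence R h t s s' = 0 := by
  rw [incidence, dif_neg hn]

variable (R) in
/-- **Duality of the Frobenius tables at `h = 0`**: exchanging `1 ↔ X` turns the multiplication
table into the (transposed) comultiplication table, `m(x̄, ȳ)_{z̄} = Δ(z)_{x ⊗ y}`; this is the
isomorphism `r : (V, m, Δ) → (V*, Δ*, m*)`, `x± ↦ x∓*` of Rasmussen (2010), proof of Prop. 3.9.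
Khovanov (2000), §7.3. [cite: Rasmussen2010, Prop. 3.9] -/
theorem mergeCoeff_not (t : R) (x y z : Bool) :
    mergeCoeff R 0 t (!x) (!y) (!z) = splitCoeff R 0 t z x y := by
  cases x <;> cases y <;> cases z <;> simp [mergeCoeff, splitCoeff]

variable (R) in
/-- Duality of the Frobenius tables at `h = 0`, comultiplication form: `Δ(x̄)_{ȳ ⊗ z̄} = m(y, z)_x`.
Rasmussen (2010), proof of Prop. 3.9. [cite: Rasmussen2010, Prop. 3.9] -/
theorem splitCoeff_not (t : R) (x y z : Bool) :
    splitCoeff R 0 t (!x) (!y) (!z) = mergeCoeff R 0 t y z x := by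
  cases x <;> cases y <;> cases z <;> simp [mergeCoeff, splitCoeff]

variable (R) in
/-- The multiplication of `R[X]/(X² - hX - t)` is commutative. Khovanov (2006), §2.
[cite: Khovanov2006, §2] -/
private theorem mergeCoeff_swap (h t : R) (x y z : Bool) :
    mergeCoeff R h t x y z = mergeCoeff R h t y x z := by
  cases x <;> cases y <;> cases z <;> rfl

variable (R) in
/-- The comultiplication of `R[X]/(X² - hX - t)` is cocommutative. Khovanov (2006), §2.
[cite: Khovanov2006, §2] -/
private theorem splitCoeff_swap (h t : R) (x y z : Bool) :
    splitCoeff R h t x y z = splitCoeff R h t x z y := by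
  cases x <;> cases y <;> cases z <;> rfl

/-- Twist parity along an edge of the cube. [folklore] -/
private theorem neg_one_pow_koszulTwist {σ : G.State} {i : Fin G.n} (hi : σ i = false) :
    ((-1 : R) ^ (State.koszulTwist (update σ i true) + σ.koszulTwist)) = (-1) ^ (i : ℕ) := by
  rw [State.koszulTwist_update hi, show σ.koszulTwist + (i : ℕ) + σ.koszulTwist = 2 * σ.koszulTwist + i by ring, pow_add,
    pow_mul]
  simp

/-- **The cube of the mirror is the dual cube** (`h = 0`): the incidence number of the mirror
diagram between mirrored enhanced states is the reversed incidence number, up to the sign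
`(-1) ^ (twist + twist')`. [cite: Khovanov2000, §7.3] -/
theorem incidence_mirror (t : R) (a a' : G.EnhancedState) :
    G.mirror.incidence R 0 t a.mirror a'.mirror =
      (-1) ^ (a.state.koszulTwist + a'.state.koszulTwist) * G.incidence R 0 t a' a := by
  by_cases hex : ∃ i, a'.state i = false ∧ a.state = update a'.state i true
  · obtain ⟨i, hi, ha⟩ := hex
    have hai : a.state i = true := by rw [ha, update_self]
    have hiM : a.mirror.state i = false := by simp [hai]
    have haM : a'.mirror.state = update a.mirror.state i true := by
      show a'.state.compl = update (State.compl a.state) i true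
      rw [ha, State.compl_update, update_idem, eq_comm, update_eq_self_iff]
      simp [hi]
    have hu : update a.state i false = a'.state := by
      rw [ha, update_idem, update_eq_self_iff, hi]
    rw [incidence_eq_ite_of_flip R 0 t hiM haM, incidence_eq_ite_of_flip R 0 t hi ha]
    have hsplit_iff : G.mirror.IsMergeAt a.mirror.state i ↔ G.IsSplitAt a'.state i := by
      rw [EnhancedState.mirror_state, isMergeAt_mirror_compl, IsSplitAt, ← ha]
      simp [hai, hi]
    have hmerge_iff : G.mirror.IsSplitAt a.mirror.state i ↔ G.IsMergeAt a'.state i := by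
      rw [EnhancedState.mirror_state, isSplitAt_mirror_compl, IsMergeAt, hu]
      simp [hai, hi]
    have hsign : (edgeSign a.mirror.state i : R) = (-1) ^ (a.state.koszulTwist + a'.state.koszulTwist) *
        (edgeSign a'.state i : R) := by
      rw [EnhancedState.mirror_state, ha, edgeSign_compl_update, neg_one_pow_koszulTwist hi]
      push_cast
      ring
    -- the two local strands at chord `i`, in `a.state` and in `a'.state`
    have hstr := underStrands_reachable a.state i
    have hstr' := underStrands_reachable a'.state i
    by_cases hm : G.IsMergeAt a'.state i
    · -- a merge of `G` is a split of the mirror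
      have hs : ¬ G.IsSplitAt a'.state i := IsMergeAt.not_isSplitAt_holds hm
      rw [if_neg (fun h ↦ hs (hsplit_iff.mp h)), if_pos (hmerge_iff.mpr hm), if_pos hm]
      -- after the merge all four local arcs lie on one circle
      have hone : (G.stateGraph a.state).Reachable (G.arcIn (G.overPos i)) (G.arcOut (G.overPos i)) := by
        by_contra hne
        exact hs ⟨hi, by rw [← ha]; exact fun h ↦ hne (SimpleGraph.ConnectedComponent.exact h)⟩
      have hInU : (G.stateGraph a.state).Reachable (G.arcIn (G.underPos i)) (G.arcIn (G.overPos i)) := by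
        rcases hstr with ⟨h1, -⟩ | ⟨h1, -⟩
        · exact h1.trans hone.symm
        · exact h1
      have hcond : (∀ c, G.mirror.circleOf a.mirror.state c ≠
            G.mirror.circleOf a.mirror.state (G.mirror.arcIn (G.mirror.overPos i)) →
            a'.mirror.label c = a.mirror.label c) ↔
          (∀ c, G.circleOf a.state c ≠ G.circleOf a.state (G.arcIn (G.overPos i)) →
            a.label c = a'.label c) := by
        refine forall_congr' fun c ↦ ?_
        rw [EnhancedState.mirror_state, circleOf_ne_mirror_compl]
        show G.circleOf a.state c ≠ G.circleOf a.state (G.arcIn (G.underPos i)) →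
            (!a'.label c) = !a.label c ↔ _
        rw [Bool.not_inj_iff]
        unfold circleOf
        rw [SimpleGraph.ConnectedComponent.sound hInU]
        exact imp_congr_right fun _ ↦ eq_comm
      by_cases hc : ∀ c, G.circleOf a.state c ≠ G.circleOf a.state (G.arcIn (G.overPos i)) →
          a.label c = a'.label c
      · rw [if_pos (hcond.mpr hc), if_pos hc, hsign]
        show (-1) ^ (a.state.koszulTwist + a'.state.koszulTwist) * (edgeSign a'.state i : R) *
            splitCoeff R 0 t (!a.label (G.arcIn (G.underPos i))) (!a'.label (G.arcIn (G.underPos i)))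
              (!a'.label (G.arcOut (G.underPos i))) = _
        rw [splitCoeff_not, a.label_eq_of_reachable hInU, mul_assoc]
        congr 2
        rcases hstr' with ⟨h1, h2⟩ | ⟨h1, h2⟩
        · rw [a'.label_eq_of_reachable h1, a'.label_eq_of_reachable h2, mergeCoeff_swap]
        · rw [a'.label_eq_of_reachable h1, a'.label_eq_of_reachable h2]
      · rw [if_neg (fun h ↦ hc (hcond.mp h)), if_neg hc, mul_zero]
    · by_cases hs : G.IsSplitAt a'.state i
      · -- a split of `G` is a merge of the mirror
        rw [if_pos (hsplit_iff.mpr hs), if_neg hm, if_pos hs]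
        -- before the split all four local arcs lie on one circle
        have hone : (G.stateGraph a'.state).Reachable (G.arcIn (G.overPos i))
            (G.arcOut (G.overPos i)) := by
          by_contra hne
          exact hm ⟨hi, fun h ↦ hne (SimpleGraph.ConnectedComponent.exact h)⟩
        have hInU : (G.stateGraph a'.state).Reachable (G.arcIn (G.underPos i))
            (G.arcIn (G.overPos i)) := by
          rcases hstr' with ⟨h1, -⟩ | ⟨h1, -⟩
          · exact h1.trans hone.symm
          · exact h1
        have hcond : (∀ c, G.mirror.circleOf a'.mirror.state c ≠
              G.mirror.circleOf a'.mirror.state (G.mirror.arcIn (G.mirror.overPos i)) →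
              a'.mirror.label c = a.mirror.label c) ↔
            (∀ c, G.circleOf a'.state c ≠ G.circleOf a'.state (G.arcIn (G.overPos i)) →
              a.label c = a'.label c) := by
          refine forall_congr' fun c ↦ ?_
          rw [EnhancedState.mirror_state, circleOf_ne_mirror_compl]
          show G.circleOf a'.state c ≠ G.circleOf a'.state (G.arcIn (G.underPos i)) →
              (!a'.label c) = !a.label c ↔ _
          rw [Bool.not_inj_iff]
          unfold circleOf
          rw [SimpleGraph.ConnectedComponent.sound hInU]
          exact imp_congr_right fun _ ↦ eq_comm
        by_cases hc : ∀ c, G.circleOf a'.state c ≠ G.circleOf a'.state (G.arcIn (G.overPos i)) →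
            a.label c = a'.label c
        · rw [if_pos (hcond.mpr hc), if_pos hc, hsign]
          show (-1) ^ (a.state.koszulTwist + a'.state.koszulTwist) * (edgeSign a'.state i : R) *
              mergeCoeff R 0 t (!a.label (G.arcIn (G.underPos i))) (!a.label (G.arcOut (G.underPos i)))
                (!a'.label (G.arcIn (G.underPos i))) = _
          rw [mergeCoeff_not, a'.label_eq_of_reachable hInU, mul_assoc]
          congr 2
          rcases hstr with ⟨h1, h2⟩ | ⟨h1, h2⟩
          · rw [a.label_eq_of_reachable h1, a.label_eq_of_reachable h2, splitCoeff_swap]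
          · rw [a.label_eq_of_reachable h1, a.label_eq_of_reachable h2]
        · rw [if_neg (fun h ↦ hc (hcond.mp h)), if_neg hc, mul_zero]
      · rw [if_neg (fun h ↦ hs (hsplit_iff.mp h)), if_neg (fun h ↦ hm (hmerge_iff.mp h)),
          if_neg hm, if_neg hs, mul_zero]
  · rw [incidence_eq_zero_of_no_flip R 0 t hex, mul_zero]
    apply incidence_eq_zero_of_no_flip
    rintro ⟨i, h1, h2⟩
    apply hex
    have hai : a.state i = true := by simpa using h1
    have ha' : a'.state = update a.state i false := by
      funext j
      have h2j := congrFun h2 j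
      rcases eq_or_ne j i with rfl | hne
      · rw [update_self]
        simpa using h2j
      · rw [update_of_ne hne]
        have h3 : update a.mirror.state i true j = a.mirror.state j := update_of_ne hne _ _
        rw [h3] at h2j
        exact Bool.not_inj h2j
    refine ⟨i, by rw [ha', update_self], ?_⟩
    rw [ha', update_idem, eq_comm, update_eq_self_iff, hai]

end Incidence

end GaussDiagram
end Literature.Topology.FourManifolds

namespace Literature.Topology.FourManifolds
namespace GaussDiagram

variable {G : GaussDiagram}

/-! ## The Lee complex of the mirror is the dual complex -/

section Dual

/-- `unmirror` is a left inverse of `mirror`. [cite: Khovanov2000, §7.3] -/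
theorem EnhancedState.unmirror_mirror (s : G.EnhancedState) : s.mirror.unmirror = s :=
  (G.mirrorStates).symm_apply_apply s

/-- `unmirror` is a right inverse of `mirror`. [cite: Khovanov2000, §7.3] -/
theorem EnhancedState.mirror_unmirror (S : G.mirror.EnhancedState) : S.unmirror.mirror = S :=
  (G.mirrorStates).apply_symm_apply S

/-- Un-mirroring negates the homological degree. Khovanov (2000), §7.3. [cite: Khovanov2000, §7.3]
-/
theorem homDegree_unmirror (S : G.mirror.EnhancedState) : homDegree S.unmirror = -homDegree S := by
  have h := homDegree_mirror S.unmirror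
  rw [EnhancedState.mirror_unmirror] at h
  omega

variable (G) in
/-- Enhanced states of `G` of homological degree `j` correspond to enhanced states of the mirror
of homological degree `i = -j`. [cite: Khovanov2000, §7.3] -/
def degStatesMirrorEquiv (i j : ℤ) (hij : i + j = 0) : G.degStates j ≃ G.mirror.degStates i where
  toFun s := ⟨s.1.mirror, by rw [homDegree_mirror, s.2]; omega⟩
  invFun S := ⟨S.1.unmirror, by rw [homDegree_unmirror, S.2]; omega⟩
  left_inv s := Subtype.ext s.1.unmirror_mirror
  right_inv S := Subtype.ext S.1.mirror_unmirror

/-- `degStatesMirrorEquiv` is `EnhancedState.mirror` on the underlying enhanced states.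
[cite: Khovanov2000, §7.3] -/
@[simp] theorem degStatesMirrorEquiv_apply_val (i j : ℤ) (hij : i + j = 0) (s : G.degStates j) :
    (G.degStatesMirrorEquiv i j hij s).1 = s.1.mirror := rfl

variable (G) in
/-- The sign twist `x ↦ ((-1) ^ twist s · x s)ₛ` on cochains of degree `j` (an involution).
[cite: Khovanov2000, §7.3] -/
def signTwist (j : ℤ) : (G.degStates j → ℚ) ≃ₗ[ℚ] (G.degStates j → ℚ) where
  toFun x s := (-1) ^ s.1.state.koszulTwist * x s
  invFun x s := (-1) ^ s.1.state.koszulTwist * x s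
  map_add' x y := funext fun s ↦ mul_add _ _ _
  map_smul' c x := funext fun s ↦ by
    simp only [Pi.smul_apply, smul_eq_mul, RingHom.id_apply]
    ring
  left_inv x := funext fun s ↦ by
    simp only
    rw [← mul_assoc, ← pow_add, ← two_mul, pow_mul]
    simp
  right_inv x := funext fun s ↦ by
    simp only
    rw [← mul_assoc, ← pow_add, ← two_mul, pow_mul]
    simp

/-- `signTwist` multiplies the coordinate at `s` by `(-1) ^ twist s`. [folklore] -/
@[simp] theorem signTwist_apply (j : ℤ) (x : G.degStates j → ℚ) (s : G.degStates j) :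
    G.signTwist j x s = (-1) ^ s.1.state.koszulTwist * x s := rfl

variable (G) in
/-- **The cochains of the mirror are the dual cochains**: the linear equivalence
`(G.mirror.degStates i → ℚ) ≃ₗ[ℚ] Dual ℚ (G.degStates j → ℚ)` (`i + j = 0`) sending `y` to the
functional `x ↦ ∑ₛ (-1) ^ twist s · y (mirror s) · x s`. [cite: Khovanov2000, §7.3] -/
def mirrorDual (i j : ℤ) (hij : i + j = 0) :
    (G.mirror.degStates i → ℚ) ≃ₗ[ℚ] Module.Dual ℚ (G.degStates j → ℚ) :=
  (LinearEquiv.funCongrLeft ℚ ℚ (G.degStatesMirrorEquiv i j hij)) ≪≫ₗ (G.signTwist j) ≪≫ₗ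
    (dotProductEquiv ℚ (G.degStates j))

/-- The functional `mirrorDual i j h y` evaluated at a cochain `x`: `∑ₛ (-1) ^ twist s · y (mirror
s) · x s`. Khovanov (2000), §7.3. [cite: Khovanov2000, §7.3] -/
theorem mirrorDual_apply (i j : ℤ) (hij : i + j = 0) (y : G.mirror.degStates i → ℚ)
    (x : G.degStates j → ℚ) :
    G.mirrorDual i j hij y x =
      ∑ s, (-1) ^ s.1.state.koszulTwist * y (G.degStatesMirrorEquiv i j hij s) * x s := rfl

/-- The differential of the mirror, transported to the dual cochains of `G`, is the dual
(transpose) of the differential of `G`: `E ∘ d_mirror = d^∨ ∘ E`. [cite: Khovanov2000, §7.3] -/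
theorem mirrorDual_khovanovD (t : ℚ) (i i' j j' : ℤ) (hij : i + j = 0) (hij' : i' + j' = 0)
    (y : G.mirror.degStates i → ℚ) :
    G.mirrorDual i' j' hij' (G.mirror.khovanovD ℚ 0 t i i' y) =
      (G.khovanovD ℚ 0 t j' j).dualMap (G.mirrorDual i j hij y) := by
  apply LinearMap.ext
  intro x
  rw [LinearMap.dualMap_apply, mirrorDual_apply, mirrorDual_apply]
  simp only [khovanovD, Matrix.toLin'_apply, Matrix.mulVec, dotProduct, Matrix.of_apply]
  -- reindex the inner sum on the left over `G.degStates j`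
  have hre : ∀ s' : G.degStates j',
      (∑ S : G.mirror.degStates i, G.mirror.incidence ℚ 0 t S.1
          (G.degStatesMirrorEquiv i' j' hij' s').1 * y S) =
        ∑ s : G.degStates j, G.mirror.incidence ℚ 0 t (G.degStatesMirrorEquiv i j hij s).1
          (G.degStatesMirrorEquiv i' j' hij' s').1 * y (G.degStatesMirrorEquiv i j hij s) :=
    fun s' ↦ (Equiv.sum_comp (G.degStatesMirrorEquiv i j hij) _).symm
  simp only [hre]
  simp only [degStatesMirrorEquiv_apply_val, incidence_mirror, Finset.mul_sum, Finset.sum_mul]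
  rw [Finset.sum_comm]
  refine Finset.sum_congr rfl fun s _ ↦ Finset.sum_congr rfl fun s' _ ↦ ?_
  have hsq : ((-1 : ℚ) ^ s'.1.state.koszulTwist) * (-1) ^ s'.1.state.koszulTwist = 1 := by
    rw [← pow_add, ← two_mul, pow_mul]
    simp
  rw [pow_add]
  linear_combination ((-1 : ℚ) ^ s.1.state.koszulTwist * G.incidence ℚ 0 t s'.1 s.1 *
    y (G.degStatesMirrorEquiv i j hij s) * x s') * hsq

end Dual

end GaussDiagram
end Literature.Topology.FourManifolds

/-! ## Filtered duality (linear algebra) -/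

namespace Literature.Topology.FourManifolds

namespace LeeDuality

open Module

/-- The order-reversing involution `k ↦ -k`, `⊥ ↦ ⊤`, `⊤ ↦ ⊥` of `WithBot (WithTop ℤ)`. [folklore]
-/
def negDeg (a : WithBot (WithTop ℤ)) : WithBot (WithTop ℤ) :=
  WithBot.recBotCoe (C := fun _ ↦ WithBot (WithTop ℤ)) ⊤
    (fun x ↦ WithTop.recTopCoe (C := fun _ ↦ WithBot (WithTop ℤ)) ⊥
      (fun k ↦ (((-k : ℤ) : WithTop ℤ) : WithBot (WithTop ℤ))) x) a

/-- `negDeg ⊥ = ⊤`. [folklore] -/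
@[simp] theorem negDeg_bot : negDeg ⊥ = ⊤ := rfl

/-- `negDeg ⊤ = ⊥`. [folklore] -/
@[simp] theorem negDeg_top : negDeg ⊤ = ⊥ := rfl

/-- `negDeg k = -k` on integers. [folklore] -/
@[simp] theorem negDeg_coe (k : ℤ) :
    negDeg ((k : WithTop ℤ) : WithBot (WithTop ℤ)) = (((-k : ℤ) : WithTop ℤ) : WithBot (WithTop ℤ)) :=
  rfl

/-- Integrality of `WithBot (WithTop ℤ)`: `¬ k ≤ a ↔ a ≤ k - 1`. [folklore] -/
theorem not_coe_le_iff (a : WithBot (WithTop ℤ)) (k : ℤ) :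
    ¬ ((k : WithTop ℤ) : WithBot (WithTop ℤ)) ≤ a ↔ a ≤ ((k - 1 : ℤ) : WithTop ℤ) := by
  induction a using WithBot.recBotCoe with
  | bot => simp
  | coe x =>
    induction x using WithTop.recTopCoe with
    | top => simp
    | coe m =>
      simp only [WithBot.coe_le_coe, WithTop.coe_le_coe]
      omega

/-- Integrality of `WithBot (WithTop ℤ)`: `¬ a ≤ k ↔ k + 1 ≤ a`. [folklore] -/
theorem not_le_coe_iff (a : WithBot (WithTop ℤ)) (k : ℤ) :
    ¬ a ≤ ((k : WithTop ℤ) : WithBot (WithTop ℤ)) ↔ (((k + 1 : ℤ) : WithTop ℤ) : WithBot (WithTop ℤ)) ≤ a := by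
  induction a using WithBot.recBotCoe with
  | bot => simp
  | coe x =>
    induction x using WithTop.recTopCoe with
    | top => simp
    | coe m =>
      simp only [WithBot.coe_le_coe, WithTop.coe_le_coe]
      omega

/-- An element `a` of `WithBot (WithTop ℤ)` with `a ≤ k ↔ -k ≤ c` for all integers `k` is `negDeg
c`. [folklore] -/
theorem eq_negDeg_of_forall {a c : WithBot (WithTop ℤ)}
    (h : ∀ k : ℤ, a ≤ ((k : WithTop ℤ) : WithBot (WithTop ℤ)) ↔
      (((-k : ℤ) : WithTop ℤ) : WithBot (WithTop ℤ)) ≤ c) :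
    a = negDeg c := by
  induction c using WithBot.recBotCoe with
  | bot =>
    rw [negDeg_bot]
    induction a using WithBot.recBotCoe with
    | bot => exact absurd ((h 0).mp bot_le) (by simp)
    | coe x =>
      induction x using WithTop.recTopCoe with
      | top => rfl
      | coe m => exact absurd ((h m).mp le_rfl) (by simp)
  | coe x =>
    induction x using WithTop.recTopCoe with
    | top =>
      rw [show ((⊤ : WithTop ℤ) : WithBot (WithTop ℤ)) = ⊤ from rfl, negDeg_top]
      induction a using WithBot.recBotCoe with
      | bot => rfl
      | coe y =>
        induction y using WithTop.recTopCoe with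
        | top =>
          exact absurd (WithBot.coe_le_coe.mp ((h 0).mpr (by simp))) (WithTop.not_top_le_coe _)
        | coe m =>
          have h1 := (h (m - 1)).mpr (by simp)
          simp only [WithBot.coe_le_coe, WithTop.coe_le_coe] at h1
          omega
    | coe n =>
      rw [negDeg_coe]
      induction a using WithBot.recBotCoe with
      | bot =>
        have h1 := (h (-n - 1)).mp bot_le
        simp only [WithBot.coe_le_coe, WithTop.coe_le_coe] at h1
        omega
      | coe y =>
        induction y using WithTop.recTopCoe with
        | top =>
          have h1 := (h (-n)).mpr (by simp)
          simp at h1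
        | coe m =>
          have h1 := (h (-n)).mpr (by simp)
          have h2 := (not_iff_not.mpr (h (-n - 1))).mpr (by
            simp only [WithBot.coe_le_coe, WithTop.coe_le_coe]; omega)
          simp only [WithBot.coe_le_coe, WithTop.coe_le_coe] at h1 h2
          have : m = -n := by omega
          rw [this]


/-- `negDeg` is an involution. [folklore] -/
theorem negDeg_negDeg (a : WithBot (WithTop ℤ)) : negDeg (negDeg a) = a := by
  induction a using WithBot.recBotCoe with
  | bot => rfl
  | coe x =>
    induction x using WithTop.recTopCoe with
    | top => rfl
    | coe m => rw [negDeg_coe, negDeg_coe, neg_neg]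

/-- An element `a` of `WithBot (WithTop ℤ)` with `k ≤ a ↔ c ≤ -k` for all integers `k` is
`negDeg c`. [folklore] -/
theorem eq_negDeg_of_forall' {a c : WithBot (WithTop ℤ)}
    (h : ∀ k : ℤ, ((k : WithTop ℤ) : WithBot (WithTop ℤ)) ≤ a ↔
      c ≤ (((-k : ℤ) : WithTop ℤ) : WithBot (WithTop ℤ))) :
    a = negDeg c := by
  have hc : c = negDeg a := eq_negDeg_of_forall fun k ↦ by simpa using (h (-k)).symm
  rw [hc, negDeg_negDeg]

variable {K : Type*} [Field K] {V : Type*} [AddCommGroup V] [Module K V] {ι : Type*}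

/-- The **filtration degree** of a vector: the least degree `q s` of a basis vector `b s` in its
support (`⊤` for the zero vector). [cite: Rasmussen2010, Def. 3.1] -/
def suppMin (b : Basis ι K V) (q : ι → ℤ) (x : V) : WithBot (WithTop ℤ) :=
  ⨅ s ∈ {s | b.repr x s ≠ 0}, ((q s : WithTop ℤ) : WithBot (WithTop ℤ))

/-- `s_max` of the subquotient `Z / (Z ⊓ B)`: the best filtration degree of a vector of `Z`
off `B`. [cite: Rasmussen2010, Def. 3.1] -/
def sMaxOf (b : Basis ι K V) (q : ι → ℤ) (Z B : Submodule K V) : WithBot (WithTop ℤ) :=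
  ⨆ z ∈ {z | z ∈ Z ∧ z ∉ B}, suppMin b q z

/-- `s_min` of the subquotient `Z / (Z ⊓ B)`: the least, over the nonzero classes, of the best
filtration degree of a representative. [cite: Rasmussen2010, Def. 3.1] -/
def sMinOf (b : Basis ι K V) (q : ι → ℤ) (Z B : Submodule K V) : WithBot (WithTop ℤ) :=
  ⨅ z ∈ {z | z ∈ Z ∧ z ∉ B}, ⨆ z' ∈ {z' | z' ∈ Z ∧ z' - z ∈ B}, suppMin b q z'

/-- The filtration step `F_k = span {b s | k ≤ q s}`. [cite: Rasmussen2010, Def. 3.1] -/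
def filt (b : Basis ι K V) (q : ι → ℤ) (k : ℤ) : Submodule K V :=
  Submodule.span K (b '' {s | k ≤ q s})

/-- Membership in the filtration step `F_k`: all basis vectors in the support have degree `≥ k`.
[folklore] -/
theorem mem_filt_iff {b : Basis ι K V} {q : ι → ℤ} {k : ℤ} {x : V} :
    x ∈ filt b q k ↔ ∀ s, b.repr x s ≠ 0 → k ≤ q s := by
  rw [filt, Basis.mem_span_image]
  simp only [Set.subset_def, Finset.mem_coe, Finsupp.mem_support_iff, Set.mem_setOf_eq]

/-- `k ≤ suppMin x` iff all basis vectors in the support of `x` have degree `≥ k`. [folklore] -/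
theorem coe_le_suppMin_iff {b : Basis ι K V} {q : ι → ℤ} {k : ℤ} {x : V} :
    ((k : WithTop ℤ) : WithBot (WithTop ℤ)) ≤ suppMin b q x ↔ ∀ s, b.repr x s ≠ 0 → k ≤ q s := by
  simp only [suppMin, le_iInf_iff, Set.mem_setOf_eq, WithBot.coe_le_coe, WithTop.coe_le_coe]

/-- `k ≤ suppMin x ↔ x ∈ F_k`. [folklore] -/
theorem coe_le_suppMin_iff_mem_filt {b : Basis ι K V} {q : ι → ℤ} {k : ℤ} {x : V} :
    ((k : WithTop ℤ) : WithBot (WithTop ℤ)) ≤ suppMin b q x ↔ x ∈ filt b q k := by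
  rw [coe_le_suppMin_iff, mem_filt_iff]

/-- In `WithBot (WithTop ℤ)` a supremum exceeds an integer only if some term does. [folklore] -/
theorem coe_le_iSup₂_iff {X : Type*} {S : Set X} {f : X → WithBot (WithTop ℤ)} {k : ℤ} :
    ((k : WithTop ℤ) : WithBot (WithTop ℤ)) ≤ ⨆ z ∈ S, f z ↔
      ∃ z ∈ S, ((k : WithTop ℤ) : WithBot (WithTop ℤ)) ≤ f z := by
  constructor
  · intro h
    by_contra hne
    have h1 : ⨆ z ∈ S, f z ≤ ((k - 1 : ℤ) : WithTop ℤ) :=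
      iSup₂_le fun z hz ↦ (not_coe_le_iff _ _).mp fun hle ↦ hne ⟨z, hz, hle⟩
    have h2 := h.trans h1
    simp only [WithBot.coe_le_coe, WithTop.coe_le_coe] at h2
    omega
  · rintro ⟨z, hz, h⟩
    exact le_iSup₂_of_le z hz h

/-- `s_max(Z/B) ≤ k ↔ Z ⊓ F_{k+1} ≤ B` (no nonzero class is represented in filtration `k + 1`).
Rasmussen (2010), §3 (Def. 3.1). [cite: Rasmussen2010, Def. 3.1] -/
theorem sMaxOf_le_coe_iff {b : Basis ι K V} {q : ι → ℤ} {Z B : Submodule K V} {k : ℤ} :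
    sMaxOf b q Z B ≤ ((k : WithTop ℤ) : WithBot (WithTop ℤ)) ↔ Z ⊓ filt b q (k + 1) ≤ B := by
  rw [sMaxOf, iSup₂_le_iff]
  constructor
  · intro h z hz
    rw [Submodule.mem_inf] at hz
    by_contra hzB
    have h1 := h z ⟨hz.1, hzB⟩
    have h2 : (((k + 1 : ℤ) : WithTop ℤ) : WithBot (WithTop ℤ)) ≤ suppMin b q z :=
      coe_le_suppMin_iff_mem_filt.mpr hz.2
    have h3 := h2.trans h1
    simp only [WithBot.coe_le_coe, WithTop.coe_le_coe] at h3
    omega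
  · rintro h z ⟨hzZ, hzB⟩
    by_contra hlt
    rw [not_le_coe_iff] at hlt
    exact hzB (h (Submodule.mem_inf.mpr ⟨hzZ, coe_le_suppMin_iff_mem_filt.mp hlt⟩))

/-- `k ≤ s_min(Z/B) ↔ Z ≤ B ⊔ (Z ⊓ F_k)` (every class is represented in filtration `k`). Rasmussen
(2010), §3 (Def. 3.1). [cite: Rasmussen2010, Def. 3.1] -/
theorem coe_le_sMinOf_iff {b : Basis ι K V} {q : ι → ℤ} {Z B : Submodule K V} {k : ℤ} :
    ((k : WithTop ℤ) : WithBot (WithTop ℤ)) ≤ sMinOf b q Z B ↔ Z ≤ B ⊔ (Z ⊓ filt b q k) := by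
  rw [sMinOf, le_iInf₂_iff]
  constructor
  · intro h z hzZ
    by_cases hzB : z ∈ B
    · exact Submodule.mem_sup_left hzB
    · obtain ⟨z', ⟨hz'Z, hz'B⟩, hk⟩ := coe_le_iSup₂_iff.mp (h z ⟨hzZ, hzB⟩)
      have hz'F : z' ∈ filt b q k := coe_le_suppMin_iff_mem_filt.mp hk
      rw [show z = z' - (z' - z) from (sub_sub_cancel z' z).symm]
      exact Submodule.sub_mem _ (Submodule.mem_sup_right (Submodule.mem_inf.mpr ⟨hz'Z, hz'F⟩))
        (Submodule.mem_sup_left hz'B)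
  · rintro h z ⟨hzZ, hzB⟩
    obtain ⟨u, hu, z', hz', huz⟩ := Submodule.mem_sup.mp (h hzZ)
    rw [Submodule.mem_inf] at hz'
    refine coe_le_iSup₂_iff.mpr ⟨z', ⟨hz'.1, ?_⟩, coe_le_suppMin_iff_mem_filt.mpr hz'.2⟩
    rw [show z' - z = -u by rw [← huz]; abel]
    exact B.neg_mem hu

/-- The dual filtration is the annihilator filtration: for the dual basis and the negated
grading, `F*_k = (F_{1-k})⁰`. [cite: Rasmussen2010, Prop. 3.9] -/
theorem filt_dualBasis [Fintype ι] [DecidableEq ι] (b : Basis ι K V) (q : ι → ℤ) (k : ℤ) :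
    filt b.dualBasis (fun s ↦ -q s) k = (filt b q (1 - k)).dualAnnihilator := by
  ext φ
  rw [mem_filt_iff, Submodule.mem_dualAnnihilator]
  simp only [Basis.dualBasis_repr]
  constructor
  · intro h w hw
    have hle : filt b q (1 - k) ≤ LinearMap.ker φ := by
      rw [filt, Submodule.span_le]
      rintro _ ⟨s, hs, rfl⟩
      rw [SetLike.mem_coe, LinearMap.mem_ker]
      by_contra hne
      have := h s hne
      simp only [Set.mem_setOf_eq] at hs
      omega
    exact hle hw
  · intro h s hs
    by_contra hlt
    exact hs (h _ (Submodule.subset_span ⟨s, by simp only [Set.mem_setOf_eq]; omega, rfl⟩))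

/-- **Filtered duality.** For `B ≤ Z ≤ V` (`V` finite-dimensional with basis `b` and grading
`q`), the `s_max` of the dual subquotient `B⁰ / Z⁰` for the dual basis and the negated grading
is minus the `s_min` of `Z / B`. [cite: Rasmussen2010, Prop. 3.9] -/
theorem sMaxOf_dual [Fintype ι] [DecidableEq ι] (b : Basis ι K V) (q : ι → ℤ)
    {Z B : Submodule K V} (hBZ : B ≤ Z) :
    sMaxOf b.dualBasis (fun s ↦ -q s) B.dualAnnihilator Z.dualAnnihilator =
      negDeg (sMinOf b q Z B) := by
  apply eq_negDeg_of_forall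
  intro k
  rw [sMaxOf_le_coe_iff, filt_dualBasis, show (1 - (k + 1) : ℤ) = -k by ring,
    ← Submodule.dualAnnihilator_sup_eq, Subspace.dualAnnihilator_le_dualAnnihilator_iff,
    coe_le_sMinOf_iff]
  constructor
  · intro h
    calc Z = (B ⊔ filt b q (-k)) ⊓ Z := (inf_eq_right.mpr h).symm
      _ = B ⊔ filt b q (-k) ⊓ Z := sup_inf_assoc_of_le _ hBZ
      _ = B ⊔ Z ⊓ filt b q (-k) := by rw [inf_comm]
      _ ≤ B ⊔ Z ⊓ filt b q (-k) := le_rfl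
  · intro h
    exact h.trans (sup_le_sup_left inf_le_right _)

/-- Transport of `sMaxOf` along a linear equivalence compatible with the filtration degrees.
[folklore] -/
theorem sMaxOf_comap {V' : Type*} [AddCommGroup V'] [Module K V'] {ι' : Type*}
    (e : V ≃ₗ[K] V') (b : Basis ι K V) (q : ι → ℤ) (b' : Basis ι' K V') (q' : ι' → ℤ)
    (h : ∀ x, suppMin b q x = suppMin b' q' (e x)) (Z B : Submodule K V') :
    sMaxOf b q (Z.comap (e : V →ₗ[K] V')) (B.comap (e : V →ₗ[K] V')) = sMaxOf b' q' Z B := by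
  simp only [sMaxOf, Set.mem_setOf_eq, Submodule.mem_comap, LinearEquiv.coe_coe, h]
  exact e.surjective.iSup_comp (fun y ↦ ⨆ (_ : y ∈ Z ∧ y ∉ B), suppMin b' q' y)


/-- **Filtered duality, second form.** For `B ≤ Z ≤ V`, the `s_min` of the dual subquotient
`B⁰ / Z⁰` (dual basis, negated grading) is minus the `s_max` of `Z / B`:
`k ≤ s_min' ↔ B⁰ ≤ (Z ⊓ (B ⊔ F_{1-k}))⁰ ↔ Z ⊓ (B ⊔ F_{1-k}) ≤ B ↔ Z ⊓ F_{1-k} ≤ B ↔ s_max ≤ -k`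
(modular law). Rasmussen (2010), Prop. 3.9 (`s_min(K̄) = -s_max(K)`).
[cite: Rasmussen2010, Prop. 3.9] -/
theorem sMinOf_dual [Fintype ι] [DecidableEq ι] (b : Basis ι K V) (q : ι → ℤ)
    {Z B : Submodule K V} (hBZ : B ≤ Z) :
    sMinOf b.dualBasis (fun s ↦ -q s) B.dualAnnihilator Z.dualAnnihilator =
      negDeg (sMaxOf b q Z B) := by
  apply eq_negDeg_of_forall'
  intro k
  rw [coe_le_sMinOf_iff, filt_dualBasis, ← Submodule.dualAnnihilator_sup_eq,
    ← Subspace.dualAnnihilator_inf_eq, Subspace.dualAnnihilator_le_dualAnnihilator_iff,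
    sMaxOf_le_coe_iff, show (-k + 1 : ℤ) = 1 - k by ring]
  constructor
  · exact fun h ↦ le_trans (inf_le_inf_left _ le_sup_right) h
  · intro h
    calc Z ⊓ (B ⊔ filt b q (1 - k)) = (B ⊔ filt b q (1 - k)) ⊓ Z := inf_comm _ _
      _ = B ⊔ filt b q (1 - k) ⊓ Z := sup_inf_assoc_of_le _ hBZ
      _ ≤ B := sup_le le_rfl (by rw [inf_comm]; exact h)

/-- Transport of `sMinOf` along a linear equivalence compatible with the filtration degrees.
[folklore] -/
theorem sMinOf_comap {V' : Type*} [AddCommGroup V'] [Module K V'] {ι' : Type*}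
    (e : V ≃ₗ[K] V') (b : Basis ι K V) (q : ι → ℤ) (b' : Basis ι' K V') (q' : ι' → ℤ)
    (h : ∀ x, suppMin b q x = suppMin b' q' (e x)) (Z B : Submodule K V') :
    sMinOf b q (Z.comap (e : V →ₗ[K] V')) (B.comap (e : V →ₗ[K] V')) = sMinOf b' q' Z B := by
  simp only [sMinOf, Set.mem_setOf_eq, Submodule.mem_comap, LinearEquiv.coe_coe, map_sub, h]
  refine e.surjective.iInf_congr e fun x ↦ iInf_congr fun _ ↦ ?_
  exact (e.surjective.iSup_comp fun y' ↦ ⨆ (_ : y' ∈ Z ∧ y' - e x ∈ B), suppMin b' q' y').symm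

end LeeDuality

end Literature.Topology.FourManifolds

/-! ## `s_max` of the mirror is `-s_min` -/

namespace Literature.Topology.FourManifolds

namespace GaussDiagram

open Module LeeDuality

variable {G : GaussDiagram}

/-- The filtration degree `qMin` of `LeeRasmussen` is `suppMin` for the standard basis of cochains
and the quantum grading. Rasmussen (2010), §2.2. [cite: Rasmussen2010, Def. 3.1] -/
theorem qMin_eq_suppMin (x : G.degStates 0 → ℚ) :
    qMin x = suppMin (Pi.basisFun ℚ (G.degStates 0)) (fun s ↦ qDegree s.1) x := by
  simp only [qMin, suppMin, Pi.basisFun_repr]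

variable (G) in
/-- `s_max` in elementary terms: the best filtration degree of a cycle that is not a boundary.
[cite: Rasmussen2010, Def. 3.1] -/
theorem leeSMax_eq_sMaxOf : G.leeSMax = sMaxOf (Pi.basisFun ℚ (G.degStates 0)) (fun s ↦ qDegree s.1)
    (LinearMap.ker (G.khovanovD ℚ 0 1 0 (0 + 1))) (LinearMap.range (G.khovanovD ℚ 0 1 (0 - 1) 0)) := by
  apply le_antisymm
  · refine iSup₂_le fun α hα ↦ iSup₂_le fun z hz ↦ ?_
    have hz : Submodule.Quotient.mk z = α := hz
    have hzB : z.1 ∉ LinearMap.range (G.khovanovD ℚ 0 1 (0 - 1) 0) := fun hmem ↦ hα (by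
      rw [← hz]
      exact (Submodule.Quotient.mk_eq_zero _).mpr (Submodule.mem_comap.mpr hmem))
    exact le_iSup₂_of_le z.1 ⟨z.2, hzB⟩ (le_of_eq (qMin_eq_suppMin z.1))
  · refine iSup₂_le fun v hv ↦ ?_
    obtain ⟨hvZ, hvB⟩ := hv
    have hne : (Submodule.Quotient.mk ⟨v, hvZ⟩ : G.LeeHomologyZero) ≠ 0 := fun h0 ↦
      hvB (Submodule.mem_comap.mp ((Submodule.Quotient.mk_eq_zero _).mp h0))
    exact le_iSup₂_of_le (Submodule.Quotient.mk ⟨v, hvZ⟩) hne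
      (le_iSup₂_of_le ⟨v, hvZ⟩ rfl (ge_of_eq (qMin_eq_suppMin v)))

variable (G) in
/-- `s_min` in elementary terms. [cite: Rasmussen2010, Def. 3.1] -/
theorem leeSMin_eq_sMinOf : G.leeSMin = sMinOf (Pi.basisFun ℚ (G.degStates 0)) (fun s ↦ qDegree s.1)
    (LinearMap.ker (G.khovanovD ℚ 0 1 0 (0 + 1))) (LinearMap.range (G.khovanovD ℚ 0 1 (0 - 1) 0)) := by
  apply le_antisymm
  · refine le_iInf₂ fun v hv ↦ ?_
    obtain ⟨hvZ, hvB⟩ := hv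
    have hne : (Submodule.Quotient.mk ⟨v, hvZ⟩ : G.LeeHomologyZero) ≠ 0 := fun h0 ↦
      hvB (Submodule.mem_comap.mp ((Submodule.Quotient.mk_eq_zero _).mp h0))
    refine iInf₂_le_of_le (Submodule.Quotient.mk ⟨v, hvZ⟩) hne (iSup₂_le fun z hz ↦ ?_)
    have hz : Submodule.Quotient.mk z = Submodule.Quotient.mk ⟨v, hvZ⟩ := hz
    have hzv : z.1 - v ∈ LinearMap.range (G.khovanovD ℚ 0 1 (0 - 1) 0) :=
      Submodule.mem_comap.mp ((Submodule.Quotient.eq _).mp hz)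
    exact le_iSup₂_of_le z.1 ⟨z.2, hzv⟩ (le_of_eq (qMin_eq_suppMin z.1))
  · refine le_iInf₂ fun α hα ↦ ?_
    obtain ⟨z₀, hz₀⟩ := Submodule.Quotient.mk_surjective _ α
    have hz₀B : z₀.1 ∉ LinearMap.range (G.khovanovD ℚ 0 1 (0 - 1) 0) := fun hmem ↦ hα (by
      rw [← hz₀]
      exact (Submodule.Quotient.mk_eq_zero _).mpr (Submodule.mem_comap.mpr hmem))
    refine iInf₂_le_of_le z₀.1 ⟨z₀.2, hz₀B⟩ (iSup₂_le fun v hv ↦ ?_)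
    obtain ⟨hvZ, hvB⟩ := hv
    have hmk : (Submodule.Quotient.mk ⟨v, hvZ⟩ : G.LeeHomologyZero) = α := by
      rw [← hz₀]
      exact (Submodule.Quotient.eq _).mpr (Submodule.mem_comap.mpr hvB)
    exact le_iSup₂_of_le ⟨v, hvZ⟩ hmk (ge_of_eq (qMin_eq_suppMin v))

/-- A lower bound for all quantum degrees in homological degree `0`. [folklore] -/
private theorem negSumAbs_le_qDegree (s : G.degStates 0) :
    -(∑ s' : G.degStates 0, |qDegree s'.1|) ≤ qDegree s.1 := by
  have h1 : |qDegree s.1| ≤ ∑ s' : G.degStates 0, |qDegree s'.1| :=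
    Finset.single_le_sum (f := fun s' : G.degStates 0 ↦ |qDegree s'.1|) (fun _ _ ↦ abs_nonneg _)
      (Finset.mem_univ s)
  have h2 := neg_abs_le (qDegree s.1)
  omega

/-- An upper bound for all quantum degrees in homological degree `0`. [folklore] -/
private theorem qDegree_le_sumAbs (s : G.degStates 0) :
    qDegree s.1 ≤ ∑ s' : G.degStates 0, |qDegree s'.1| := by
  have h1 : |qDegree s.1| ≤ ∑ s' : G.degStates 0, |qDegree s'.1| :=
    Finset.single_le_sum (f := fun s' : G.degStates 0 ↦ |qDegree s'.1|) (fun _ _ ↦ abs_nonneg _)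
      (Finset.mem_univ s)
  have h2 := le_abs_self (qDegree s.1)
  omega

variable (G) in
/-- `s_min` is never `⊥`: filtration degrees are bounded below. [cite: Rasmussen2010, Def. 3.1] -/
theorem leeSMin_ne_bot : G.leeSMin ≠ ⊥ := by
  intro h
  have hle : (((-(∑ s' : G.degStates 0, |qDegree s'.1|) : ℤ) : WithTop ℤ) : WithBot (WithTop ℤ)) ≤
      G.leeSMin := by
    refine le_iInf₂ fun α _ ↦ ?_
    obtain ⟨z₀, hz₀⟩ := Submodule.Quotient.mk_surjective _ α
    refine le_iSup₂_of_le z₀ hz₀ (le_iInf₂ fun s _ ↦ ?_)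
    exact_mod_cast negSumAbs_le_qDegree s
  rw [h, le_bot_iff] at hle
  exact WithBot.coe_ne_bot hle

variable (G) in
/-- `s_max` is never `⊤`: a nonzero class has only nonzero representatives.
[cite: Rasmussen2010, Def. 3.1] -/
theorem leeSMax_ne_top : G.leeSMax ≠ ⊤ := by
  intro h
  have hle : G.leeSMax ≤ (((∑ s' : G.degStates 0, |qDegree s'.1|) : ℤ) : WithTop ℤ) := by
    refine iSup₂_le fun α hα ↦ iSup₂_le fun z hz ↦ ?_
    have hz : Submodule.Quotient.mk z = α := hz
    have hz0 : z.1 ≠ 0 := by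
      intro h0
      apply hα
      rw [← hz, show z = 0 from Subtype.ext h0]
      exact (Submodule.Quotient.mk_eq_zero _).mpr (Submodule.zero_mem _)
    obtain ⟨s, hs⟩ : ∃ s, z.1 s ≠ 0 := by
      by_contra! hall
      exact hz0 (funext hall)
    exact (iInf₂_le s hs).trans (by exact_mod_cast qDegree_le_sumAbs s)
  rw [h, top_le_iff] at hle
  exact WithTop.coe_ne_top (WithBot.coe_eq_top.mp hle)

/-- The degree-zero cycles of the mirror are the annihilator of the degree-zero boundaries.
[cite: Rasmussen2010, Prop. 3.9] -/
theorem ker_mirror_eq :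
    LinearMap.ker (G.mirror.khovanovD ℚ 0 1 0 (0 + 1)) =
      (LinearMap.range (G.khovanovD ℚ 0 1 (0 - 1) 0)).dualAnnihilator.comap
        (G.mirrorDual 0 0 (add_zero 0) : (G.mirror.degStates 0 → ℚ) →ₗ[ℚ] Dual ℚ (G.degStates 0 → ℚ)) := by
  ext y
  rw [LinearMap.mem_ker, Submodule.mem_comap, ← LinearMap.ker_dualMap_eq_dualAnnihilator_range,
    LinearMap.mem_ker, LinearEquiv.coe_coe,
    ← mirrorDual_khovanovD 1 0 (0 + 1) 0 (0 - 1) (add_zero 0) (by norm_num),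
    LinearEquiv.map_eq_zero_iff]

/-- The degree-zero boundaries of the mirror are the annihilator of the degree-zero cycles.
[cite: Rasmussen2010, Prop. 3.9] -/
theorem range_mirror_eq :
    LinearMap.range (G.mirror.khovanovD ℚ 0 1 (0 - 1) 0) =
      (LinearMap.ker (G.khovanovD ℚ 0 1 0 (0 + 1))).dualAnnihilator.comap
        (G.mirrorDual 0 0 (add_zero 0) : (G.mirror.degStates 0 → ℚ) →ₗ[ℚ] Dual ℚ (G.degStates 0 → ℚ)) := by
  ext x
  rw [Submodule.mem_comap, ← LinearMap.range_dualMap_eq_dualAnnihilator_ker, LinearMap.mem_range,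
    LinearMap.mem_range, LinearEquiv.coe_coe]
  constructor
  · rintro ⟨y, rfl⟩
    exact ⟨G.mirrorDual (0 - 1) (0 + 1) (by norm_num) y,
      (mirrorDual_khovanovD 1 (0 - 1) 0 (0 + 1) 0 (by norm_num) (add_zero 0) y).symm⟩
  · rintro ⟨φ, hφ⟩
    refine ⟨(G.mirrorDual (0 - 1) (0 + 1) (by norm_num)).symm φ, ?_⟩
    apply (G.mirrorDual 0 0 (add_zero 0)).injective
    rw [mirrorDual_khovanovD 1 (0 - 1) 0 (0 + 1) 0 (by norm_num) (add_zero 0),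
      LinearEquiv.apply_symm_apply, hφ]

/-- The transport `mirrorDual 0 0` matches filtration degrees: mirrored states have negated
quantum degrees. [cite: Rasmussen2010, Prop. 3.9] -/
theorem suppMin_mirrorDual (y : G.mirror.degStates 0 → ℚ) :
    suppMin (Pi.basisFun ℚ (G.mirror.degStates 0)) (fun S ↦ qDegree S.1) y =
      suppMin (Pi.basisFun ℚ (G.degStates 0)).dualBasis (fun s ↦ -qDegree s.1)
        (G.mirrorDual 0 0 (add_zero 0) y) := by
  simp only [suppMin, Pi.basisFun_repr, Basis.dualBasis_repr, Pi.basisFun_apply]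
  have hev : ∀ s : G.degStates 0, G.mirrorDual 0 0 (add_zero 0) y (Pi.single s 1) =
      (-1) ^ s.1.state.koszulTwist * y (G.degStatesMirrorEquiv 0 0 (add_zero 0) s) := by
    intro s
    rw [mirrorDual_apply, Finset.sum_eq_single s]
    · simp
    · intro c _ hc
      simp [Pi.single_eq_of_ne hc]
    · intro h
      exact absurd (Finset.mem_univ s) h
  symm
  refine Equiv.iInf_congr (G.degStatesMirrorEquiv 0 0 (add_zero 0)) fun s ↦ ?_
  refine iInf_congr_Prop ?_ fun _ ↦ ?_
  · simp only [Set.mem_setOf_eq, hev]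
    exact (mul_ne_zero_iff.trans (and_iff_right (pow_ne_zero _ (by norm_num)))).symm
  · rw [degStatesMirrorEquiv_apply_val, qDegree_mirror]

/-- **`s_max(Ḡ) = -s_min(G)`** for the mirror diagram `Ḡ`, provided the incoming Lee
differential lands in the cycles (`im d₋₁ ≤ ker d₀`, i.e. `d² = 0` in degree `0`).
[cite: Rasmussen2010, Prop. 3.9] -/
theorem leeSMax_mirror_eq_negDeg
    (hBZ : LinearMap.range (G.khovanovD ℚ 0 1 (0 - 1) 0) ≤ LinearMap.ker (G.khovanovD ℚ 0 1 0 (0 + 1))) :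
    G.mirror.leeSMax = negDeg G.leeSMin := by
  rw [leeSMax_eq_sMaxOf, leeSMin_eq_sMinOf, ker_mirror_eq, range_mirror_eq,
    sMaxOf_comap (G.mirrorDual 0 0 (add_zero 0)) _ _ _ _ suppMin_mirrorDual,
    sMaxOf_dual _ _ hBZ]


/-- **`s_min(Ḡ) = -s_max(G)`** for the mirror diagram `Ḡ`, provided `im d₋₁ ≤ ker d₀`
(second line of Rasmussen (2010), Prop. 3.9). [cite: Rasmussen2010, Prop. 3.9] -/
theorem leeSMin_mirror_eq_negDeg
    (hBZ : LinearMap.range (G.khovanovD ℚ 0 1 (0 - 1) 0) ≤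
      LinearMap.ker (G.khovanovD ℚ 0 1 0 (0 + 1))) :
    G.mirror.leeSMin = negDeg G.leeSMax := by
  rw [leeSMin_eq_sMinOf, leeSMax_eq_sMaxOf, ker_mirror_eq, range_mirror_eq,
    sMinOf_comap (G.mirrorDual 0 0 (add_zero 0)) _ _ _ _ suppMin_mirrorDual,
    sMinOf_dual _ _ hBZ]

/-- `d² = 0` with reindexed degrees. [cite: Khovanov2000, Prop. 8] -/
private theorem khovanovD_comp_eq_zero_reindex {i j k : ℤ} (hj : i + 1 = j) (hk : i + 1 + 1 = k)
    (h : G.khovanovD ℚ 0 1 (i + 1) (i + 1 + 1) ∘ₗ G.khovanovD ℚ 0 1 i (i + 1) = 0) :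
    G.khovanovD ℚ 0 1 j k ∘ₗ G.khovanovD ℚ 0 1 i j = 0 := by
  subst hj hk
  exact h

/-- **Mirror image, conditional form.** `s(Ḡ) = -s(G)` for a Gauss diagram `G` whose Lee
differential satisfies `im d₋₁ ≤ ker d₀` and whose `s_max = s_min + 2`.
[cite: Rasmussen2010, Prop. 3.9] -/
theorem rasmussenInvariant_mirror_of_le
    (hBZ : LinearMap.range (G.khovanovD ℚ 0 1 (0 - 1) 0) ≤ LinearMap.ker (G.khovanovD ℚ 0 1 0 (0 + 1)))
    (h2 : G.leeSMax = G.leeSMin + 2) :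
    G.mirror.rasmussenInvariant = -G.rasmussenInvariant := by
  have hM := leeSMax_mirror_eq_negDeg hBZ
  have hbot := G.leeSMin_ne_bot
  have htop := G.leeSMax_ne_top
  unfold rasmussenInvariant
  rw [hM, h2]
  rw [h2] at htop
  generalize G.leeSMin = m at hbot htop
  induction m using WithBot.recBotCoe with
  | bot => exact absurd rfl hbot
  | coe x =>
    induction x using WithTop.recTopCoe with
    | top => exact absurd rfl htop
    | coe m =>
      rw [negDeg_coe, show ((m : WithTop ℤ) : WithBot (WithTop ℤ)) + 2 =
        (((m + 2 : ℤ) : WithTop ℤ) : WithBot (WithTop ℤ)) by norm_cast]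
      simp only [WithBot.unbotD_coe, WithTop.untopD_coe]
      ring

/-- **Mirror image: `s(K̄) = -s(K)`, reduced to `d² = 0` and `s_max = s_min + 2`.** The named
fact `rasmussenInvariant_mirror` follows from the named facts `khovanovD_comp_khovanovD` (over
`ℚ`, for every Gauss diagram) and `leeSMax_eq_leeSMin_add_two`. [cite: Rasmussen2010, Prop. 3.9] -/
theorem rasmussenInvariant_mirror_of (hd : ∀ G : GaussDiagram, G.khovanovD_comp_khovanovD ℚ)
    (h2 : leeSMax_eq_leeSMin_add_two) : rasmussenInvariant_mirror := by
  intro G hG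
  refine rasmussenInvariant_mirror_of_le (LinearMap.range_le_ker_iff.mpr ?_) (h2 hG)
  exact khovanovD_comp_eq_zero_reindex (by norm_num) (by norm_num) (hd G 0 1 hG (0 - 1))

end GaussDiagram

end Literature.Topology.FourManifolds
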